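import Literature.NumberTheory.Transcendental.PointStep
import HarnessLib

/-!
# Baker's method on `M_κ`: the extrapolation estimate

Topic: `Literature/NumberTheory/Transcendental`. Plan item W4/S5(f, analytic part) of the unit
`provefact-Literature.NumberTheory.Transcendental.H-b596640137`. The analytic upper bound for
the extrapolation functions of the auxiliary form at a new point `s`, from their zeros of order
`≥ T - k` at `0, 1, …, S₀` (`Extrapolation.le_analyticOrderAt_extrapFun`), their growth
(`Extrapolation.norm_extrapFun_le`) and the maximum modulus principle with multiplicities
(`Baker1975.Analytic.norm_le_of_analyticOrderAt`, `BakerLogarithmsAnalytic.lean`). PROVED: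

* `l1Norm_homog_QOf_le` — `‖P‖₁ ≤ ∑_u |ξ_u| ≤ #unknowns · H_ξ` for `P = homog D (QOf ξ)`;
* `norm_gridDir_le` — `‖x_c‖ ≤ k · ∑_m ‖x_m‖` for `c_m ≤ k`;
* `BakerData.norm_extrapFun_grid_le` — for `R ≥ 2(s + S₀) > 0`:
  `|φ_{x_c,k}(s)| ≤ k! · #U · H_ξ · e^{C(1 + (R‖v‖ + k X)²)·D} · (2(s+S₀)/R)^{(T-k)(S₀+1)}`,
  `X = ∑ ‖x_m‖`, `C` the theta growth constant.

## References

* A. Baker, *Transcendental Number Theory*, CUP 1975, Ch. 2, Lemmas 4–5.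
* A. Baker, G. Wüstholz, *Logarithmic Forms and Diophantine Geometry*, CUP 2007, §6.8 (p. 119).
-/

noncomputable section

open Complex MvPolynomial Finset NumberField Metric
open scoped PeriodPair

namespace Literature.NumberTheory.Transcendental

namespace GaGmE

namespace Std

namespace BakerData

variable {β γ δ : Type} [Fintype β] [Fintype γ] [Fintype δ] [DecidableEq γ]
variable [DecidableEq β] [DecidableEq δ] (B : BakerData β γ δ)

/-! ### Sizes of the auxiliary form and of the grid directions -/

/-- `‖homog D (QOf ξ)‖₁ ≤ ∑_u |ξ_u|`. [folklore] -/
theorem l1Norm_homog_QOf_le {D' : ℕ} (ξ : UIdx β γ δ D' → 𝓞 B.K) :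
    Nesterenko.l1Norm (B.auxForm ξ) ≤ ∑ u, ‖B.emb ((ξ u : 𝓞 B.K) : B.K)‖ := by
  unfold Nesterenko.l1Norm auxForm
  rw [homog_QOf]
  -- `coeff_J (∑_u C a_u * m_u) = ∑_u a_u * coeff_J m_u` and `∑_J |coeff_J m_u| = 1`
  set D := Fintype.card (β ⊕ (γ ⊕ δ)) * D' with hD
  have hmon : ∀ u : UIdx β γ δ D', ∃ J : (Option β × ThetaIdx γ δ) →₀ ℕ,
      (homogMonomialᵣ D (νOf u) : MvPolynomial (Option β × ThetaIdx γ δ) ℂ) = monomial J 1 := by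
    intro u
    refine ⟨Finsupp.single (baseIdx (genericChart (γ := γ))) (D - (νOf u).degree) + (νOf u).mapDomain affIdx, ?_⟩
    rw [homogMonomialᵣ, X_pow_eq_monomial, monomial_mul, one_mul]
  choose J hJ using hmon
  have hsum : (∑ u, C (B.emb ((ξ u : 𝓞 B.K) : B.K)) * homogMonomialᵣ D (νOf u) :
      MvPolynomial (Option β × ThetaIdx γ δ) ℂ) = ∑ u, monomial (J u) (B.emb ((ξ u : 𝓞 B.K) : B.K)) := by
    refine Finset.sum_congr rfl fun u _ => ?_
    rw [hJ u, C_mul_monomial, mul_one]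
  rw [hsum]
  -- bound the ℓ¹ norm of a sum of monomials
  calc ∑ I ∈ (∑ u, monomial (J u) (B.emb ((ξ u : 𝓞 B.K) : B.K))).support,
        ‖coeff I (∑ u, monomial (J u) (B.emb ((ξ u : 𝓞 B.K) : B.K)))‖
      ≤ ∑ I ∈ (∑ u, monomial (J u) (B.emb ((ξ u : 𝓞 B.K) : B.K))).support,
          ∑ u, ‖coeff I (monomial (J u) (B.emb ((ξ u : 𝓞 B.K) : B.K)))‖ := by
        refine Finset.sum_le_sum fun I _ => ?_
        rw [coeff_sum]
        exact norm_sum_le _ _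
    _ = ∑ u, ∑ I ∈ (∑ u, monomial (J u) (B.emb ((ξ u : 𝓞 B.K) : B.K))).support,
          ‖coeff I (monomial (J u) (B.emb ((ξ u : 𝓞 B.K) : B.K)))‖ := Finset.sum_comm
    _ ≤ ∑ u, ‖B.emb ((ξ u : 𝓞 B.K) : B.K)‖ := by
        refine Finset.sum_le_sum fun u _ => ?_
        by_cases hmem : J u ∈ (∑ u, monomial (J u) (B.emb ((ξ u : 𝓞 B.K) : B.K))).support
        · rw [← Finset.add_sum_erase _ _ hmem, coeff_monomial, if_pos rfl]
          have : ∑ I ∈ ((∑ u, monomial (J u) (B.emb ((ξ u : 𝓞 B.K) : B.K))).support).erase (J u),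
              ‖coeff I (monomial (J u) (B.emb ((ξ u : 𝓞 B.K) : B.K)))‖ = 0 := by
            refine Finset.sum_eq_zero fun I hI => ?_
            rw [coeff_monomial, if_neg (Finset.ne_of_mem_erase hI).symm, norm_zero]
          rw [this, add_zero]
        · have h0 : ∑ I ∈ (∑ u, monomial (J u) (B.emb ((ξ u : 𝓞 B.K) : B.K))).support,
              ‖coeff I (monomial (J u) (B.emb ((ξ u : 𝓞 B.K) : B.K)))‖ = 0 :=
            Finset.sum_eq_zero fun I hI => by
              rw [coeff_monomial, if_neg (fun h => hmem (by rw [h]; exact hI)), norm_zero]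
          rw [h0]; exact norm_nonneg _

/-- `∑_u |ξ_u| ≤ #U · H_ξ`. [folklore] -/
theorem sum_norm_xi_le {D' : ℕ} (ξ : UIdx β γ δ D' → 𝓞 B.K) :
    ∑ u, ‖B.emb ((ξ u : 𝓞 B.K) : B.K)‖ ≤ Fintype.card (UIdx β γ δ D') * B.houseXi ξ := by
  calc ∑ u, ‖B.emb ((ξ u : 𝓞 B.K) : B.K)‖ ≤ ∑ _u : UIdx β γ δ D', B.houseXi ξ :=
        Finset.sum_le_sum fun u _ => B.norm_embedding_xi_le ξ B.emb u
    _ = Fintype.card (UIdx β γ δ D') * B.houseXi ξ := by rw [Finset.sum_const, nsmul_eq_mul, Finset.card_univ]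

/-- The size of the directions `X = ∑_m ‖x_m‖`. [folklore] -/
def dirNorm : ℝ := ∑ m, ‖B.xs m‖

omit [DecidableEq β] [DecidableEq δ] in
/-- `0 ≤ X`. [folklore] -/
theorem dirNorm_nonneg : 0 ≤ B.dirNorm := Finset.sum_nonneg fun _ _ => norm_nonneg _

omit [DecidableEq β] [DecidableEq δ] in
/-- `‖x_c‖ ≤ k · X` for `c_m ≤ k`. [folklore] -/
theorem norm_gridDir_le {k : ℕ} {cg : Fin B.dd → ℕ} (hcg : ∀ m, cg m ≤ k) :
    ‖B.gridDir cg‖ ≤ k * B.dirNorm := by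
  unfold gridDir dirNorm
  rw [Finset.mul_sum]
  refine (norm_sum_le _ _).trans (Finset.sum_le_sum fun m _ => ?_)
  rw [norm_smul, Complex.norm_natCast]
  exact mul_le_mul_of_nonneg_right (by exact_mod_cast hcg m) (norm_nonneg _)

/-! ### The extrapolation estimate -/

/-- **The extrapolation estimate.** Suppose `v ∈ 𝔟`, `F_P` vanishes to order `≥ T` along `𝔟` at
`0, v, …, S₀v`, `c_m ≤ k`, and `R ≥ 2(s + S₀)`, `R > 0`. Then, with the theta growth
constant `C`,
`|φ_{x_c,k}(s)| ≤ k!·#U·H_ξ·e^{C(1+(R‖v‖+kX)²)}^D·(2(s+S₀)/R)^{(T-k)(S₀+1)}`.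
[cite: Baker1975, Ch. 2 Lemma 4; BakerWustholz2007, §6.8 (p. 119)] -/
theorem norm_extrapFun_grid_le {C : ℝ} (hC0 : 0 ≤ C)
    (hC : ∀ (J : Option β × ThetaIdx γ δ) (w : β ⊕ (γ ⊕ δ) → ℂ),
      ‖theta B.L B.κM J w‖ ≤ Real.exp (C * (1 + ‖w‖ ^ 2)))
    (hv : B.v ∈ B.bSpan) {D' : ℕ} (ξ : UIdx β γ δ D' → 𝓞 B.K) {T S₀ : ℕ}
    (hvan : ∀ s₀ : ℕ, s₀ ≤ S₀ → VanishesAlong B.bSpan (thetaEval B.L B.κM (B.auxForm ξ)) ((s₀ : ℂ) • B.v) T)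
    {k : ℕ} {cg : Fin B.dd → ℕ} (hcg : ∀ m, cg m ≤ k) (s : ℕ) {R : ℝ} (hR0 : 0 < R)
    (hR : 2 * ((s : ℝ) + S₀) ≤ R) :
    ‖extrapFun B.L B.κM (B.auxForm ξ) B.v (B.gridDir cg) k s‖ ≤
      k.factorial * (Fintype.card (UIdx β γ δ D') * B.houseXi ξ *
        Real.exp (C * (1 + (R * ‖B.v‖ + k * B.dirNorm) ^ 2)) ^ (Fintype.card (β ⊕ (γ ⊕ δ)) * D')) *
        (2 * ((s : ℝ) + S₀) / R) ^ ((T - k) * (S₀ + 1)) := by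
  set D := Fintype.card (β ⊕ (γ ⊕ δ)) * D' with hD
  set f := extrapFun B.L B.κM (B.auxForm ξ) B.v (B.gridDir cg) k with hf
  set pts : Finset ℂ := (Finset.range (S₀ + 1)).image (fun j : ℕ => (j : ℂ)) with hpts
  have hcard : pts.card = S₀ + 1 := by
    rw [hpts, Finset.card_image_of_injective _ Nat.cast_injective, Finset.card_range]
  have hdiff : Differentiable ℂ f := differentiable_extrapFun B.L B.κM _ _ _ k
  -- orders at the points
  have hord : ∀ c ∈ pts, ((T - k : ℕ) : ℕ∞) ≤ analyticOrderAt f c := by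
    intro c hc
    obtain ⟨j, hj, rfl⟩ := Finset.mem_image.mp hc
    have hjS : j ≤ S₀ := Nat.lt_succ_iff.mp (Finset.mem_range.mp hj)
    exact le_analyticOrderAt_extrapFun B.L B.κM _ hv (B.gridDir_mem cg) (hvan j hjS) k
  -- the bound on the circle
  set θ : ℝ := k.factorial * (Nesterenko.l1Norm (B.auxForm ξ) *
    Real.exp (C * (1 + (R * ‖B.v‖ + ‖B.gridDir cg‖) ^ 2)) ^ D) with hθ
  have hθb : ∀ z ∈ sphere (0 : ℂ) R, ‖f z‖ ≤ θ := by
    intro z hz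
    have hzR : ‖z‖ = R := by simpa using hz
    have h := norm_extrapFun_le B.L B.κM hC0 hC (P := B.auxForm ξ) (D := D)
      ((isHomogeneous_homog D (B.QOf ξ)).totalDegree_le) B.v (B.gridDir cg) k z
    rw [hzR] at h
    exact h
  -- the lower bound for `∏ (z - c)^S` on the circle
  have hsep : ∀ z ∈ sphere (0 : ℂ) R, ∀ c ∈ pts, R / 2 ≤ ‖z - c‖ := by
    intro z hz c hc
    have hzR : ‖z‖ = R := by simpa using hz
    obtain ⟨j, hj, rfl⟩ := Finset.mem_image.mp hc
    have hjS : (j : ℝ) ≤ S₀ := by exact_mod_cast Nat.lt_succ_iff.mp (Finset.mem_range.mp hj)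
    have h1 : ‖z‖ - ‖(j : ℂ)‖ ≤ ‖z - (j : ℂ)‖ := norm_sub_norm_le z j
    rw [hzR, Complex.norm_natCast] at h1
    have hs0 : (0 : ℝ) ≤ s := Nat.cast_nonneg s
    linarith
  have hm : (0 : ℝ) < (R / 2) ^ ((T - k) * pts.card) := pow_pos (by linarith) _
  have hmF : ∀ z ∈ sphere (0 : ℂ) R, (R / 2) ^ ((T - k) * pts.card) ≤ ‖∏ c ∈ pts, (z - c) ^ (T - k)‖ :=
    fun z hz => Baker1975.Analytic.le_norm_prod_pow pts (T - k) (by linarith) (hsep z hz)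
  have hsR : ‖(s : ℂ)‖ ≤ R := by
    rw [Complex.norm_natCast]
    have : (0 : ℝ) ≤ S₀ := Nat.cast_nonneg S₀
    have hs0 : (0 : ℝ) ≤ s := Nat.cast_nonneg s
    linarith
  have hmain := Baker1975.Analytic.norm_le_of_analyticOrderAt hdiff pts (T - k) hord hR0 hθb hm hmF hsR
  -- `|∏ (s - c)^S| ≤ (s + S₀)^{S (S₀+1)}`
  have hup : ‖∏ c ∈ pts, ((s : ℂ) - c) ^ (T - k)‖ ≤ ((s : ℝ) + S₀) ^ ((T - k) * pts.card) := by
    refine Baker1975.Analytic.norm_prod_pow_le pts (T - k) fun c hc => ?_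
    obtain ⟨j, hj, rfl⟩ := Finset.mem_image.mp hc
    have hjS : (j : ℝ) ≤ S₀ := by exact_mod_cast Nat.lt_succ_iff.mp (Finset.mem_range.mp hj)
    calc ‖(s : ℂ) - (j : ℂ)‖ ≤ ‖(s : ℂ)‖ + ‖(j : ℂ)‖ := norm_sub_le _ _
      _ = s + j := by rw [Complex.norm_natCast, Complex.norm_natCast]
      _ ≤ s + S₀ := by linarith
  rw [hcard] at hm hup hmain
  -- assemble
  have hθ0 : 0 ≤ θ := by
    rw [hθ]; have := Nesterenko.l1Norm_nonneg (B.auxForm ξ); positivity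
  have hA0 : (0 : ℝ) ≤ (s : ℝ) + S₀ := by positivity
  have step1 : ‖f s‖ ≤ θ * (2 * ((s : ℝ) + S₀) / R) ^ ((T - k) * (S₀ + 1)) := by
    refine hmain.trans ?_
    have e : θ / (R / 2) ^ ((T - k) * (S₀ + 1)) * ((s : ℝ) + S₀) ^ ((T - k) * (S₀ + 1)) =
        θ * (2 * ((s : ℝ) + S₀) / R) ^ ((T - k) * (S₀ + 1)) := by
      rw [show 2 * ((s : ℝ) + S₀) / R = (2 / R) * ((s : ℝ) + S₀) from by ring, mul_pow, div_pow, div_pow]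
      field_simp
    rw [← e]
    exact mul_le_mul_of_nonneg_left hup (div_nonneg hθ0 hm.le)
  refine step1.trans (mul_le_mul_of_nonneg_right ?_ (by positivity))
  -- `θ ≤ k! · (#U · H_ξ · e^{…})^… `
  rw [hθ]
  refine mul_le_mul_of_nonneg_left ?_ (Nat.cast_nonneg _)
  have hX := B.norm_gridDir_le hcg
  have hexp : Real.exp (C * (1 + (R * ‖B.v‖ + ‖B.gridDir cg‖) ^ 2)) ≤
      Real.exp (C * (1 + (R * ‖B.v‖ + k * B.dirNorm) ^ 2)) := by
    refine Real.exp_le_exp.mpr (mul_le_mul_of_nonneg_left ?_ hC0)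
    have h1 : 0 ≤ R * ‖B.v‖ + ‖B.gridDir cg‖ := by positivity
    nlinarith [norm_nonneg (B.gridDir cg)]
  have hcoeff := (B.l1Norm_homog_QOf_le ξ).trans (B.sum_norm_xi_le ξ)
  have hHξ := B.one_le_houseXi ξ
  have hE1 : 1 ≤ Real.exp (C * (1 + (R * ‖B.v‖ + k * B.dirNorm) ^ 2)) := Real.one_le_exp (by positivity)
  calc Nesterenko.l1Norm (B.auxForm ξ) * Real.exp (C * (1 + (R * ‖B.v‖ + ‖B.gridDir cg‖) ^ 2)) ^ D
      ≤ (Fintype.card (UIdx β γ δ D') * B.houseXi ξ) * Real.exp (C * (1 + (R * ‖B.v‖ + k * B.dirNorm) ^ 2)) ^ D :=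
        mul_le_mul hcoeff (pow_le_pow_left₀ (Real.exp_nonneg _) hexp D) (pow_nonneg (Real.exp_nonneg _) _)
          (by positivity)
    _ = _ := by ring

end BakerData

end Std

end GaGmE

end Literature.NumberTheory.Transcendental

end
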